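/-
Copyright (c) 2026 the pub-hodgecm-mathlib formalisation cell (harness21).  Prover seat hodgecm-mathlib-LH4-p09 (g9), req620 Track A «(D-RAM) FOUR-FRAME» squad
(STAGE-1b, row (2) of the piece `f_{T₊}`, the (β₂) road; dealer∕pen LH4-plan (g13) WORD #120 «(M4-hi) POPULATEDNESS ∕ LABEL TRANSPORT OF THE NEAR-SIMILITUDE FLIPS»;
data of record F0P3-p01 (g36) HP-WITNESS-TABLE v1 5cca8016), 2026-09-04.
-/
import Summits.HodgeConjecture.HodgeConjecture.Theorems.F0P3cDyRamConeCellLabelBalance   -- ★ p860765 (this seat): `dualGen_mul_left`; brings ★ DEFS leaf `F0P3cDyRamToricCensusDefs` (`dualGen`, `glueUnit`)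
import HarnessLib

/-!
# Crux `H413`, line LH4 «(D-RAM) FOUR-FRAME» — STAGE-1b, row (2), the (β₂) road, (M4-hi): «THE NEAR-SIMILITUDE TRANSPORT LETTERS» — how the GLUE UNIT and the line-model
# TRACE FORM move under `x₀ ↦ ε·x₀` when the `Θ`-norm `ν = ε·Θε` is NOT `ρ`-fixed: the half-trace identity `2·Tr_ρ(νs) = Tr_ρ(ν)·Tr_ρ(s) + (ν − ρν)(s − ρs)`

Cell `hodgecm-mathlib` (D-0151), FLOOR 0, crux item H413 = `stmt-HodgeConjecture-24833`, route of record `HCCMUnconditional`; squad F0∕P3c∕LH4; lane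
`--supports stmt-HodgeConjecture-24833 --as helper` (count-neutral; pays NO tier-0 row).  THEOREMS ONLY (no `def`, no instance, no notation, no `sorry`, default heartbeats).
DATUM-FREE algebra in the M-letters of ★ DEFS `F0P3cDyRamToricCensusDefs` (`K` a field, `ρ Θ : K →+* K`, `Θ` an involution where said; no valuation is used).

WHY (F0P3-p01 (g36) TORUS-FLIP ∕ ORBIT-SCAN ∕ HP-WITNESS-TABLE v1; LH4-p16 (g0) SIG-FaceTube (M4-hi); this seat's caveat 14:43:32Z).  On a tube cell at∕above the glue conductor
(`d ≤ b`) the admissible label-reversing torus units `ε` have `Θ`-norm `ν = ε·Θε` in `F` only modulo deep units (`ρν ≠ ν`; table column «ξ ≡ 3 ∈ F (mod ϖ^f·)», or «ξ ∉ F»),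
and an EXACT-`F` flip (`ρν = ν`, ★ `ConeWeightHalfSplit.glueUnit_mul_left`: `r ↦ r∕ν`) REVERSES populatedness there (★ T1 §3).  What decides populatedness and the plane value
set for a general `ν` is the ρ-TRACE of a PRODUCT, and the one identity that governs it is
  `2·(νs + ρ(νs)) = (ν + ρν)(s + ρs) + (ν − ρν)(s − ρs)`      (`two_mul_trace_mul`; any ring map `ρ`, no involutivity):
the symmetric part of `ν` SCALES the trace, the anti-symmetric part couples to the anti-symmetric part of `s`.  Read on the two census letters:
* §2 THE GLUE UNIT (★ DEFS `glueUnit = −(t + ρt)·(ϖE·ΘϖE)^b ∕ c_U`, `t = h·(x₀Θx₀) ∕ (Y·ΘY)`, `Y = dualGen`): under `x₀ ↦ ε·x₀` with `ε·Θε = ν` one has `Y ↦ ν·Y`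
  (★ `dualGen_mul_left`), `t ↦ t ∕ ν` (`lineRatio_mul_left`), hence **`two_mul_glueUnit_mul_left`**:
  `2·glueUnit(ε·x₀) = (ν⁻¹ + ρν⁻¹)·glueUnit(x₀) − (ν⁻¹ − ρν⁻¹)·(t − ρt)·(ϖE·ΘϖE)^b ∕ c_U` — for `ρν = ν` the correction vanishes and `glueUnit(ε·x₀) = glueUnit(x₀)∕ν` (★ p11); for a
  near-`F` `ν` the correction is (anti-symmetric part of `ν⁻¹`) × (anti-symmetric part of `t`), which on deep cells (where `Tr_ρ t` is much smaller than `t`) is what lets an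
  `ω(ν_F) = −1` flip KEEP the norm class of the glue unit (HP-TABLE: ℚ₂(i) (8,4)@(10,10), (6,4)@(8,6)) — the (M4-hi) populatedness letter in closed form.
* §3 THE TRACE FORM of the line model (★ (C1) `hform`: `jE⟨x, y⟩_{H₂} = h_M·Θ(φx)·φy + ρ(h_M·Θ(φx)·φy)`): for a plane map `ε` transported to multiplication by `e` (`φ(ε x) = e·φ x`),
  `jE⟨εx, εy⟩ = νs + ρ(νs)` with `ν = e·Θe`, `s = h_M·Θ(φx)·φy` (`map_pairing_mulVec_mulVec_eq`), hence **`two_mul_map_pairing_mulVec_mulVec`**: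
  `2·jE⟨εx, εy⟩ = (ν + ρν)·jE⟨x, y⟩ + (ν − ρν)·(s − ρs)` — for `ρν = ν` the similitude letter of ★ p861069 `…GlueLabelPlaneScaling` (`⟨εx, εy⟩ = ν⟨x, y⟩`), in general the
  (M4-hi) label-transport letter in closed form.
HONEST LABEL.  Count-neutral algebra; nothing printed is asserted; no census law is stated; which `ε` keep populatedness ∕ reverse labels on which cell is DATA (HP-TABLE) until the
per-cell arithmetic is typed; (β₂) stays a HYPOTHESIS; `HC_CM` is proved only modulo the 7 printed citations (2 remaining named inputs: hLiu418 = `stmt-HodgeConjecture-24832`,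
h413 = `stmt-HodgeConjecture-24833`) until rung 0 closes.
## References
* [Jacobowitz1962] R. Jacobowitz, *Hermitian forms over local fields*, Amer. J. Math. 84 (1962): §4 (dual lattices, gluing, the norm residue of the glue).
* [Kottwitz1986BaseChangeUnits] R. E. Kottwitz, *Base change for unit elements of Hecke algebras*, Compositio Math. 60 (1986): §1 pp. 240–241.
* [Rogawski1990] J. D. Rogawski, *Automorphic Representations of Unitary Groups in Three Variables*, Ann. of Math. Stud. 123 (1990): §4.9 Prop. 4.9.1 (b) p. 55.
-/

set_option autoImplicit false

namespace Summit.HodgeConjecture.HodgeConjecture.Cruxes.H413.F0P3cDyRamGlueUnitNearSimilitude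

open Summit.HodgeConjecture.HodgeConjecture.Cruxes.H413.F0P3cDyRamToricCensusDefs
open Summit.HodgeConjecture.HodgeConjecture.Cruxes.H413.F0P3cDyRamConeCellLabelBalance (dualGen_mul_left)

variable {K : Type*} [Field K] {ρ Θ : K →+* K} {α : K}

/-! ## §1 The half-trace identity -/

/-- **THE HALF-TRACE IDENTITY**: `2·(νs + ρ(νs)) = (ν + ρν)·(s + ρs) + (ν − ρν)·(s − ρs)` for any ring map `ρ` — the symmetric part of `ν` scales the `ρ`-trace of `s`, the
anti-symmetric part couples to the anti-symmetric part of `s`. [cite: Jacobowitz1962, §4] -/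
theorem two_mul_trace_mul (ρ : K →+* K) (ν s : K) : 2 * (ν * s + ρ (ν * s)) = (ν + ρ ν) * (s + ρ s) + (ν - ρ ν) * (s - ρ s) := by
  rw [map_mul]; ring

/-- The same for the inverse multiplier: `2·(s∕ν + ρ(s∕ν)) = (ν⁻¹ + ρν⁻¹)·(s + ρs) + (ν⁻¹ − ρν⁻¹)·(s − ρs)`. [cite: Jacobowitz1962, §4] -/
theorem two_mul_trace_div (ρ : K →+* K) (ν s : K) : 2 * (s / ν + ρ (s / ν)) = (ν⁻¹ + ρ ν⁻¹) * (s + ρ s) + (ν⁻¹ - ρ ν⁻¹) * (s - ρ s) := by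
  rw [div_eq_mul_inv, mul_comm s, map_inv₀]
  have := two_mul_trace_mul ρ ν⁻¹ s
  rw [map_inv₀] at this
  exact this

/-! ## §2 The glue unit under `x₀ ↦ ε·x₀` with `ε·Θε = ν` (any unit `ν`, `ρν = ν` NOT assumed) -/

/-- **THE LINE RATIO `t = h·(x₀Θx₀) ∕ (Y·ΘY)` DIVIDES BY `ν`**: with `Y = dualGen` (`Y(ε·x₀) = ν·Y(x₀)`, ★ `dualGen_mul_left`) and `Θ` an involution (so `Θν = ν`),
`t(ε·x₀) = t(x₀) ∕ ν` (`ν ≠ 0`, `Y(x₀) ≠ 0`). [cite: Jacobowitz1962, §4] -/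
theorem lineRatio_mul_left (hΘΘ : ∀ x, Θ (Θ x) = x) {ε ν : K} (hε : ε * Θ ε = ν) (hν0 : ν ≠ 0) (c h : K) {x₀ : K}
    (hY0 : dualGen ρ Θ α c h x₀ ≠ 0) :
    h * (ε * x₀ * Θ (ε * x₀)) / (dualGen ρ Θ α c h (ε * x₀) * Θ (dualGen ρ Θ α c h (ε * x₀))) =
      (h * (x₀ * Θ x₀) / (dualGen ρ Θ α c h x₀ * Θ (dualGen ρ Θ α c h x₀))) / ν := by
  have hΘν : Θ ν = ν := by rw [← hε, map_mul, hΘΘ, mul_comm]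
  have hΘY0 : Θ (dualGen ρ Θ α c h x₀) ≠ 0 := (map_ne_zero Θ).2 hY0
  rw [dualGen_mul_left, hε, map_mul Θ ν, hΘν, map_mul Θ ε x₀,
    show h * (ε * x₀ * (Θ ε * Θ x₀)) = (ε * Θ ε) * (h * (x₀ * Θ x₀)) by ring, hε]
  field_simp

/-- **THE GLUE UNIT UNDER A NEAR-SIMILITUDE — CLOSED FORM.**  For `ε·Θε = ν` (`Θ` an involution, `ν ≠ 0`, `Y(x₀) ≠ 0`), with `t = h·(x₀Θx₀) ∕ (Y·ΘY)`:
`2·glueUnit(ε·x₀) = (ν⁻¹ + ρν⁻¹)·glueUnit(x₀) − (ν⁻¹ − ρν⁻¹)·(t − ρt)·(ϖE·ΘϖE)^b ∕ c_U`.  For `ρν = ν` the correction vanishes (`glueUnit(ε·x₀) = glueUnit(x₀)∕ν`, ★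
`ConeWeightHalfSplit.glueUnit_mul_left`); in general the correction is (anti-symmetric part of `ν⁻¹`) × (anti-symmetric part of `t`) — the (M4-hi) populatedness letter.
[cite: Jacobowitz1962, §4] [cite: Kottwitz1986BaseChangeUnits, §1 pp. 240–241] -/
theorem two_mul_glueUnit_mul_left (hΘΘ : ∀ x, Θ (Θ x) = x) {ε ν : K} (hε : ε * Θ ε = ν) (hν0 : ν ≠ 0) (c h ϖE cU : K) {x₀ : K}
    (hY0 : dualGen ρ Θ α c h x₀ ≠ 0) (b : ℕ) :
    2 * glueUnit ρ Θ α c h ϖE cU (ε * x₀) b =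
      (ν⁻¹ + ρ ν⁻¹) * glueUnit ρ Θ α c h ϖE cU x₀ b -
        (ν⁻¹ - ρ ν⁻¹) * ((h * (x₀ * Θ x₀) / (dualGen ρ Θ α c h x₀ * Θ (dualGen ρ Θ α c h x₀))) -
          ρ (h * (x₀ * Θ x₀) / (dualGen ρ Θ α c h x₀ * Θ (dualGen ρ Θ α c h x₀)))) * (ϖE * Θ ϖE) ^ b / cU := by
  set t : K := h * (x₀ * Θ x₀) / (dualGen ρ Θ α c h x₀ * Θ (dualGen ρ Θ α c h x₀)) with ht
  rw [glueUnit_def, glueUnit_def, lineRatio_mul_left hΘΘ hε hν0 c h hY0, ← ht]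
  have key := two_mul_trace_div ρ ν t
  -- `2·(−(t∕ν + ρ(t∕ν))·κ∕cU) = −(2·(t∕ν + ρ(t∕ν)))·κ∕cU`
  rw [show 2 * -((t / ν + ρ (t / ν)) * (ϖE * Θ ϖE) ^ b / cU) = -(2 * (t / ν + ρ (t / ν))) * (ϖE * Θ ϖE) ^ b / cU by ring, key]
  ring

/-! ## §3 The line-model trace form under a plane map transported to multiplication by `e` -/

/-- **THE PAIRING OF TWO TRANSPORTED VECTORS IS A `ρ`-TRACE OF `ν·s`**: with the value dictionary `jE⟨x, y⟩ = h_M·Θ(φx)·φy + ρ(h_M·Θ(φx)·φy)` (★ (C1) `hform`) and a plane map `ε`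
read as multiplication by `e` on the line model (`φ(ε x) = e·φ x`), `jE⟨εx, εy⟩ = ν·s + ρ(ν·s)` with `ν = e·Θe`, `s = h_M·Θ(φx)·φy`.
[cite: Jacobowitz1962, §4] [cite: Rogawski1990, §4.9 Prop. 4.9.1 (b) p. 55] -/
theorem map_pairing_mulVec_mulVec_eq {E M V : Type*} [Field M] {ρM ΘM : M →+* M} (jE : E → M) (pair : V → V → E) (φ : V → M) (hM : M)
    (hform : ∀ x y, jE (pair x y) = hM * ΘM (φ x) * φ y + ρM (hM * ΘM (φ x) * φ y))
    (εV : V → V) {e : M} (hφε : ∀ x, φ (εV x) = e * φ x) (x y : V) :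
    jE (pair (εV x) (εV y)) = (e * ΘM e) * (hM * ΘM (φ x) * φ y) + ρM ((e * ΘM e) * (hM * ΘM (φ x) * φ y)) := by
  rw [hform, hφε, hφε, map_mul, show hM * (ΘM e * ΘM (φ x)) * (e * φ y) = (e * ΘM e) * (hM * ΘM (φ x) * φ y) by ring]

/-- **THE TRACE FORM UNDER A NEAR-SIMILITUDE — CLOSED FORM**: same letters, `ν = e·Θe`, `s = h_M·Θ(φx)·φy`:
`2·jE⟨εx, εy⟩ = (ν + ρν)·jE⟨x, y⟩ + (ν − ρν)·(s − ρs)` — for `ρν = ν` this is the similitude letter `jE⟨εx, εy⟩ = ν·jE⟨x, y⟩` of ★ p861069; in general the (M4-hi)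
label-transport letter (symmetric part scales, anti-symmetric part perturbs). [cite: Jacobowitz1962, §4] [cite: Rogawski1990, §4.9 Prop. 4.9.1 (b) p. 55] -/
theorem two_mul_map_pairing_mulVec_mulVec {E M V : Type*} [Field M] {ρM ΘM : M →+* M} (jE : E → M) (pair : V → V → E) (φ : V → M) (hM : M)
    (hform : ∀ x y, jE (pair x y) = hM * ΘM (φ x) * φ y + ρM (hM * ΘM (φ x) * φ y))
    (εV : V → V) {e : M} (hφε : ∀ x, φ (εV x) = e * φ x) (x y : V) :
    2 * jE (pair (εV x) (εV y)) =
      (e * ΘM e + ρM (e * ΘM e)) * jE (pair x y) + (e * ΘM e - ρM (e * ΘM e)) * (hM * ΘM (φ x) * φ y - ρM (hM * ΘM (φ x) * φ y)) := by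
  rw [map_pairing_mulVec_mulVec_eq jE pair φ hM hform εV hφε, hform, two_mul_trace_mul]

/-- **THE `ρ`-FIXED CASE IS THE SIMILITUDE LETTER**: if `ρ(e·Θe) = e·Θe` then `jE⟨εx, εy⟩ = (e·Θe)·jE⟨x, y⟩` (the hypothesis `hε` of ★ p861069 `planeValueSet_map_eq_image_mul`,
read through the dictionary). [cite: Jacobowitz1962, §4] -/
theorem map_pairing_mulVec_mulVec_eq_mul_of_map_eq {E M V : Type*} [Field M] {ρM ΘM : M →+* M} (jE : E → M) (pair : V → V → E) (φ : V → M) (hM : M)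
    (hform : ∀ x y, jE (pair x y) = hM * ΘM (φ x) * φ y + ρM (hM * ΘM (φ x) * φ y))
    (εV : V → V) {e : M} (hφε : ∀ x, φ (εV x) = e * φ x) (hρν : ρM (e * ΘM e) = e * ΘM e) (x y : V) :
    jE (pair (εV x) (εV y)) = (e * ΘM e) * jE (pair x y) := by
  rw [map_pairing_mulVec_mulVec_eq jE pair φ hM hform εV hφε, hform, map_mul, hρν]
  ring

end Summit.HodgeConjecture.HodgeConjecture.Cruxes.H413.F0P3cDyRamGlueUnitNearSimilitude
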